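import Literature.NumberTheory.K2Lit.SiegelDoubledUnipotent
import Literature.NumberTheory.K2Lit.LocalDoublingSiegel                      -- ★ `siegelDeltaLoc` (the pattern `comap (locToAdelic v)`)
import Literature.NumberTheory.GelbartRogawski1991.DoubledUnitarySiegelPlaceComponents
import Literature.NumberTheory.Automorphic.UnitaryGroupAdelicProduct
import HarnessLib

/-!
# Crux `HLiu418`, Road Φ of socket #41, organ Φ3b — DEFS LEAF 1: the Siegel unipotent radical `N_Δ` PLACE BY PLACE
# (`N_Δ(𝔸_f)`, `N_Δ(L⁺_v)`, `N_Δ(L⁺ ⊗ ℝ)`) and the componentwise membership criterion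

Cell `hodgecm-mathlib`, crux item hLiu418 = `stmt-HodgeConjecture-24832`, route of record `HCCMUnconditional`; squad K2 ∕ K2Liu, road `K2_Liu`,
socket #41 `sig_K2LiuSiegelEisensteinContinuation`, Road Φ (LEAD F0P6-plan (g11) ruling «M-155l»), organ Φ3b «`N_Δ(𝔸)` as a restricted product»
(census `K2/K2Liu-p03/g5/CENSUS-PHI3-PureTensorEuler…md` §1 row Φ3b; seat `hodgecm-mathlib-K2Liu-p03` (g5)).  DEFINITIONS WITH BODIES + their
algebra (the cell's DEFS lane, as ★ `K2LiuSiegelUnipotentFourierDefs`); no `instance`, no `notation`, no named-fact hypothesis, no `sorry`;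
lane `--supports stmt-HodgeConjecture-24832`.  Pattern = ★ `LocalDoublingSiegel.siegelDeltaLoc := (siegelDelta).comap (locToAdelic v)` and ★
`DoubledUnitarySiegelPlaceComponents` (`IsSiegelM`, `isSiegelDelta_locToAdelic_iff`), ★ `UnitaryGroupRestrictedProduct.finAdelicEquiv` (restriction +
cut-out).

WHY.  The Euler product of the Fourier coefficient `W_β(f_s)(h) = ∫_{N_Δ(𝔸)} conj ψ_β(u) f_s(w_Δ u h) dνN(u)` (Φ2 ★ `whittakerDelta`, K2Liu-p06) over the
places of `L⁺` needs the Haar measure `νN` of `N_Δ(𝔸)` (★ D9 `unipDelta`, a `Subgroup` of `H(𝔸)`) split along `N_Δ(𝔸) = N_Δ(L⁺ ⊗ ℝ) × ∏'_v N_Δ(L⁺_v)`.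
★ D9 knows `N_Δ(𝔸)` only through the adelic block identity `E₁ · blk u · E₂ = (1 X; 0 1)`; this leaf reads that identity COMPONENTWISE, exactly as ★
`DoubledUnitarySiegelPlaceComponents` does for `P_Δ` (`IsSiegelM`, `isSiegelDelta_locToAdelic_iff`):

* §1 `IsUnipM M` — the matrix-level predicate (three block equations `M₁₁ + M₁₂ = 1`, `M₂₁ + M₂₂ = 1`, `M₂₂ − M₁₂ = 1` in the enumeration `e₂`), stable
  under ring homomorphisms, tested componentwise over a product ring and over `𝔸_L^∞` (`isUnipM_iff_forall_place`); `mem_unipDelta_iff_isUnipM`.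
* §2 `unipDeltaFin := (unipDelta).comap finAdelicToAdelic ≤ H(𝔸_f)` with `mem_unipDeltaFin_iff_isUnipM`; `unipDeltaArch := (unipDelta).comap archToAdelic ≤ H_∞`;
  **`mem_unipDelta_iff_archPart_finPart : u ∈ N_Δ(𝔸) ↔ u_∞ ∈ N_Δ(L⁺ ⊗ ℝ) ∧ u_f ∈ N_Δ(𝔸_f)`** (★ `archToAdelic_mul_finAdelicToAdelic`).
* §3 `unipDeltaLoc v := (unipDelta).comap (locToAdelic v) ≤ H(L⁺_v)` with `mem_unipDeltaLoc_iff_isUnipM : u ∈ N_Δ(L⁺_v) ↔ ∀ w ∣ v, IsUnipM (u_w)`,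
  `unipDeltaLoc_le_siegelDeltaLoc`, and **`mem_unipDeltaFin_iff_forall_evalPlace : b ∈ N_Δ(𝔸_f) ↔ ∀ v, b_v ∈ N_Δ(L⁺_v)`** (`b_v` = ★ `evalPlace v b`).
  Together: `u ∈ N_Δ(𝔸) ↔ u_∞ ∈ N_Δ(L⁺ ⊗ ℝ) ∧ ∀ v, (u_f)_v ∈ N_Δ(L⁺_v)` (`mem_unipDelta_iff_components`).
  This is the input of the TOPOLOGICAL SPLITTING `unipDeltaSplit : N_Δ(𝔸) ≃ₜ* N_Δ(L⁺ ⊗ ℝ) × ∏'_v [N_Δ(L⁺_v), K_{H,v} ∩ N_Δ(L⁺_v)]` (sequel DEFS leaf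
  `K2LiuSiegelUnipotentSplitDefs`), of the Haar pinning `νN = ν_∞ ⊗ ⊗_{v∈S} ν_v ⊗ ∏'_{v∉S}(ν_v; N_Δ(𝒪_v))` and of the Euler product of ★ `whittakerDelta`
  (next files of Φ3b ∕ Φ3d).
HONEST LABEL.  Carriers only; `HC_CM` is proved only modulo the 7 printed citations (2 remaining named inputs: hLiu418 = 24832, h413 = 24833) until rung 0
closes; this file is a helper (`--supports stmt-HodgeConjecture-24832`) and closes no socket by itself.

## References
* [MoeglinWaldspurger1995] C. Mœglin, J.-L. Waldspurger, *Spectral decomposition and Eisenstein series*, CUP (1995): I.2.1 (`P = MN` over the adeles and locally).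
* [BorelJacquet1979] A. Borel, H. Jacquet, PSPM 33.1 (1979), §4.1 (`G(𝔸) = G_∞ × G(𝔸_f)`, `G(𝔸_f) = ∏'_v G(F_v)`).
* [Tan1999] V. Tan, *Poles of Siegel Eisenstein series on U(n,n)*, Canad. J. Math. 51 (1999), §§1–2 (`M(s) = ⊗_v M_v(s)` place by place).
* [Kudla1994] S. Kudla, Israel J. Math. 87 (1994), §2 (doubled space, Siegel parabolic, its unipotent radical).
-/

set_option autoImplicit false
-- the mandated namespace repeats the single-problem summit's segment (`HodgeConjecture.HodgeConjecture`)
set_option linter.dupNamespace false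

noncomputable section

open scoped Matrix RestrictedProduct
open NumberField IsDedekindDomain

namespace Summit.HodgeConjecture.HodgeConjecture.Cruxes.HLiu418.K2LiuSiegelUnipotentLocalDefs

open Literature.NumberTheory.Automorphic Literature.NumberTheory.GaloisRepresentations
open Literature.NumberTheory.GelbartRogawski1991 Literature.NumberTheory.GelbartRogawski1991.GRConstruction
open Literature.NumberTheory.K2Lit.SiegelDoubled

variable (L : Type) [Field L] [NumberField L] [IsCMField L]
variable {N M n : ℕ} (e : Fin N × Fin M ≃ Fin n)
  (dV : Fin N → L) (hdV : ∀ i, IsCMField.complexConj L (dV i) = dV i)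
  (dW : Fin M → L) (hdW : ∀ i, IsCMField.complexConj L (dW i) = dW i)

/-! ## §1 The matrix-level predicate `IsUnipM` -/

/-- **`M ∈ N_Δ` at matrix level**: in the block enumeration `e₂ : Fin n ⊕ Fin n ≃ Fin (n + n)` the blocks of `M` satisfy `M₁₁ + M₁₂ = 1`, `M₂₁ + M₂₂ = 1`
and `M₂₂ − M₁₂ = 1` — equivalently `E₁ M E₂ = (1 M₁₂; 0 1)` (★ `conjE_eq`), i.e. `M` fixes the diagonal `Δ` pointwise and acts trivially on `𝔻/Δ`.
[cite: MoeglinWaldspurger1995, I.2.1] [cite: Kudla1994, §2] -/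
def IsUnipM {R : Type*} [Ring R] (M : Matrix (Fin (n + n)) (Fin (n + n)) R) : Prop :=
  (Matrix.reindex (e₂ (n := n)).symm (e₂ (n := n)).symm M).toBlocks₁₁ + (Matrix.reindex (e₂ (n := n)).symm (e₂ (n := n)).symm M).toBlocks₁₂ = 1 ∧
    (Matrix.reindex (e₂ (n := n)).symm (e₂ (n := n)).symm M).toBlocks₂₁ + (Matrix.reindex (e₂ (n := n)).symm (e₂ (n := n)).symm M).toBlocks₂₂ = 1 ∧
      (Matrix.reindex (e₂ (n := n)).symm (e₂ (n := n)).symm M).toBlocks₂₂ - (Matrix.reindex (e₂ (n := n)).symm (e₂ (n := n)).symm M).toBlocks₁₂ = 1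

/-- **`u ∈ N_Δ(𝔸)` IS `IsUnipM` of the matrix of `u`** (★ `mem_unipDelta_iff_blocks`: `u ∈ P_Δ`, `u|_Δ = 1`, `u₂₂ − u₁₂ = 1`; and `P_Δ` is
`u₁₁ + u₁₂ = u₂₁ + u₂₂`). [cite: MoeglinWaldspurger1995, I.2.1] [cite: Kudla1994, §2] -/
theorem mem_unipDelta_iff_isUnipM (u : HA L e dV hdV dW hdW) :
    u ∈ unipDelta L e dV hdV dW hdW ↔
      IsUnipM ((u : GL (Fin (n + n)) (AdeleRing (𝓞 L) L)) : Matrix (Fin (n + n)) (Fin (n + n)) (AdeleRing (𝓞 L) L)) := by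
  rw [mem_unipDelta_iff_blocks]
  unfold IsSiegelDelta deltaBlock IsUnipM
  constructor
  · rintro ⟨h1, h2, h3⟩
    exact ⟨h2, by rw [← h1]; exact h2, h3⟩
  · rintro ⟨h1, h2, h3⟩
    exact ⟨h1.trans h2.symm, h1, h3⟩

/-- the four `e₂`-blocks commute with entrywise maps (★ `toBlocks_reindex_e₂_map`), hence ring homomorphisms preserve `IsUnipM`.
[cite: MoeglinWaldspurger1995, I.2.1] -/
theorem IsUnipM.map {R S : Type*} [CommRing R] [CommRing S] (f : R →+* S)
    {M : Matrix (Fin (n + n)) (Fin (n + n)) R} (hM : IsUnipM M) : IsUnipM (M.map f) := by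
  have h := toBlocks_reindex_e₂_map (n := n) (f : R → S) M
  unfold IsUnipM at hM ⊢
  rw [h.1, h.2.1, h.2.2.1, h.2.2.2, ← Matrix.map_add (⇑f) (map_add f), ← Matrix.map_add (⇑f) (map_add f),
    ← Matrix.map_sub (⇑f) (map_sub f), hM.1, hM.2.1, hM.2.2, Matrix.map_one (⇑f) (map_zero f) (map_one f)]
  exact ⟨rfl, rfl, rfl⟩

/-- the identity matrix is unipotent-Siegel (`1₁₁ + 1₁₂ = 1`, `1₂₁ + 1₂₂ = 1`, `1₂₂ − 1₁₂ = 1`). [cite: MoeglinWaldspurger1995, I.2.1] -/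
theorem isUnipM_one {R : Type*} [CommRing R] : IsUnipM (1 : Matrix (Fin (n + n)) (Fin (n + n)) R) := by
  unfold IsUnipM
  rw [Matrix.reindex_apply, Matrix.submatrix_one_equiv, ← Matrix.fromBlocks_one, Matrix.toBlocks_fromBlocks₁₁,
    Matrix.toBlocks_fromBlocks₁₂, Matrix.toBlocks_fromBlocks₂₁, Matrix.toBlocks_fromBlocks₂₂, add_zero, zero_add, sub_zero]
  exact ⟨rfl, rfl, rfl⟩

/-- over a product ring `IsUnipM` holds iff it holds in both components. [cite: BorelJacquet1979, §4.1] -/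
theorem isUnipM_iff_fst_snd {R S : Type*} [CommRing R] [CommRing S]
    (M : Matrix (Fin (n + n)) (Fin (n + n)) (R × S)) :
    IsUnipM M ↔ IsUnipM (M.map (RingHom.fst R S)) ∧ IsUnipM (M.map (RingHom.snd R S)) := by
  refine ⟨fun h => ⟨h.map (n := n) _, h.map (n := n) _⟩, fun h => ?_⟩
  obtain ⟨h1, h2⟩ := h
  have k1 := toBlocks_reindex_e₂_map (n := n) (RingHom.fst R S : R × S → R) M
  have k2 := toBlocks_reindex_e₂_map (n := n) (RingHom.snd R S : R × S → S) M
  unfold IsUnipM at h1 h2 ⊢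
  rw [k1.1, k1.2.1, k1.2.2.1, k1.2.2.2, ← Matrix.map_add _ (map_add _), ← Matrix.map_add _ (map_add _), ← Matrix.map_sub _ (map_sub _)] at h1
  rw [k2.1, k2.2.1, k2.2.2.1, k2.2.2.2, ← Matrix.map_add _ (map_add _), ← Matrix.map_add _ (map_add _), ← Matrix.map_sub _ (map_sub _)] at h2
  -- a matrix over `R × S` is determined by its two projections
  have key : ∀ A : Matrix (Fin n) (Fin n) (R × S), A.map (RingHom.fst R S) = 1 → A.map (RingHom.snd R S) = 1 → A = 1 := by
    intro A hA hB
    ext i j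
    · have h := congrFun (congrFun hA i) j
      rw [Matrix.map_apply, RingHom.coe_fst, Matrix.one_apply] at h
      rw [h, Matrix.one_apply]
      split_ifs <;> rfl
    · have h := congrFun (congrFun hB i) j
      rw [Matrix.map_apply, RingHom.coe_snd, Matrix.one_apply] at h
      rw [h, Matrix.one_apply]
      split_ifs <;> rfl
  exact ⟨key _ h1.1 h2.1, key _ h1.2.1 h2.2.1, key _ h1.2.2 h2.2.2⟩

omit [IsCMField L] in
/-- over `𝔸_L^∞`, `IsUnipM` holds iff it holds at every finite place `w` of `L` (★ `Matrix.finiteAdele_eq_iff_forall`).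
[cite: BorelJacquet1979, §4.1] -/
theorem isUnipM_iff_forall_place (M : Matrix (Fin (n + n)) (Fin (n + n)) (FiniteAdeleRing (𝓞 L) L)) :
    IsUnipM M ↔ ∀ w : HeightOneSpectrum (𝓞 L), IsUnipM (M.map (AdelicGroupData.finiteAdeleEval L w)) := by
  refine ⟨fun h w => h.map (n := n) _, fun h => ?_⟩
  -- each of the three block equations holds iff it holds at every place
  have hw : ∀ w : HeightOneSpectrum (𝓞 L),
      ((Matrix.reindex (e₂ (n := n)).symm (e₂ (n := n)).symm M).toBlocks₁₁ +
          (Matrix.reindex (e₂ (n := n)).symm (e₂ (n := n)).symm M).toBlocks₁₂).map (AdelicGroupData.finiteAdeleEval L w) =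
        (1 : Matrix (Fin n) (Fin n) (FiniteAdeleRing (𝓞 L) L)).map (AdelicGroupData.finiteAdeleEval L w) ∧
      ((Matrix.reindex (e₂ (n := n)).symm (e₂ (n := n)).symm M).toBlocks₂₁ +
          (Matrix.reindex (e₂ (n := n)).symm (e₂ (n := n)).symm M).toBlocks₂₂).map (AdelicGroupData.finiteAdeleEval L w) =
        (1 : Matrix (Fin n) (Fin n) (FiniteAdeleRing (𝓞 L) L)).map (AdelicGroupData.finiteAdeleEval L w) ∧
      ((Matrix.reindex (e₂ (n := n)).symm (e₂ (n := n)).symm M).toBlocks₂₂ -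
          (Matrix.reindex (e₂ (n := n)).symm (e₂ (n := n)).symm M).toBlocks₁₂).map (AdelicGroupData.finiteAdeleEval L w) =
        (1 : Matrix (Fin n) (Fin n) (FiniteAdeleRing (𝓞 L) L)).map (AdelicGroupData.finiteAdeleEval L w) := by
    intro w
    have k := toBlocks_reindex_e₂_map (n := n) (AdelicGroupData.finiteAdeleEval L w : _ → w.adicCompletion L) M
    have h' := h w
    unfold IsUnipM at h'
    rw [k.1, k.2.1, k.2.2.1, k.2.2.2, ← Matrix.map_add _ (map_add _), ← Matrix.map_add _ (map_add _),
      ← Matrix.map_sub _ (map_sub _)] at h'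
    rw [Matrix.map_one _ (map_zero _) (map_one _)]
    exact h'
  unfold IsUnipM
  refine ⟨?_, ?_, ?_⟩
  · rw [Matrix.finiteAdele_eq_iff_forall]
    exact fun w => (hw w).1
  · rw [Matrix.finiteAdele_eq_iff_forall]
    exact fun w => (hw w).2.1
  · rw [Matrix.finiteAdele_eq_iff_forall]
    exact fun w => (hw w).2.2

/-! ## §2 `N_Δ(𝔸_f)`, `N_Δ(L⁺ ⊗ ℝ)` and the archimedean ∕ finite split -/

/-- **`N_Δ(𝔸_f) ≤ H(𝔸_f)`**: the pull-back of ★ `unipDelta = N_Δ(𝔸)` along `b ↦ (1, b)` (★ `finAdelicToAdelic`). [cite: BorelJacquet1979, §4.1] -/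
def unipDeltaFin : Subgroup (UnitaryGroup.finAdelic (Fp L) L (IsCMField.complexConj L) (n + n) (hermD L e dV hdV dW hdW)) :=
  (unipDelta L e dV hdV dW hdW).comap
    (UnitaryGroup.finAdelicToAdelic (Fp L) L (IsCMField.complexConj L) (n + n) (hermD L e dV hdV dW hdW))

/-- membership: `b ∈ N_Δ(𝔸_f) ↔ (1, b) ∈ N_Δ(𝔸)`. [cite: BorelJacquet1979, §4.1] -/
theorem mem_unipDeltaFin_iff (b : UnitaryGroup.finAdelic (Fp L) L (IsCMField.complexConj L) (n + n) (hermD L e dV hdV dW hdW)) :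
    b ∈ unipDeltaFin L e dV hdV dW hdW ↔
      (UnitaryGroup.finAdelicToAdelic (Fp L) L (IsCMField.complexConj L) (n + n) (hermD L e dV hdV dW hdW) b : HA L e dV hdV dW hdW) ∈
        unipDelta L e dV hdV dW hdW :=
  Iff.rfl

/-- membership, MATRIX FORM: `b ∈ N_Δ(𝔸_f) ↔ IsUnipM (matrix of b over 𝔸_L^∞)` (the archimedean component of `(1, b)` is `1`, ★
`map_fst_coe_finAdelicToAdelic` ∕ `map_snd_coe_finAdelicToAdelic`). [cite: BorelJacquet1979, §4.1] -/
theorem mem_unipDeltaFin_iff_isUnipM (b : UnitaryGroup.finAdelic (Fp L) L (IsCMField.complexConj L) (n + n) (hermD L e dV hdV dW hdW)) :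
    b ∈ unipDeltaFin L e dV hdV dW hdW ↔
      IsUnipM ((b : GL (Fin (n + n)) (FiniteAdeleRing (𝓞 L) L)) : Matrix (Fin (n + n)) (Fin (n + n)) (FiniteAdeleRing (𝓞 L) L)) := by
  refine (mem_unipDeltaFin_iff L e dV hdV dW hdW b).trans ?_
  -- (`Iff.trans` up to the definitional identification `H(𝔸) = (adelicGroupData …).Adelic`; no `rw` across it)
  refine (mem_unipDelta_iff_isUnipM L e dV hdV dW hdW _).trans ?_
  have h := isUnipM_iff_fst_snd (n := n) (R := InfiniteAdeleRing L) (S := FiniteAdeleRing (𝓞 L) L)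
    (((UnitaryGroup.finAdelicToAdelic (Fp L) L (IsCMField.complexConj L) (n + n) (hermD L e dV hdV dW hdW) b).1 :
        GL (Fin (n + n)) (AdeleRing (𝓞 L) L)) : Matrix (Fin (n + n)) (Fin (n + n)) (AdeleRing (𝓞 L) L))
  refine h.trans ⟨fun k => (congrArg IsUnipM (map_snd_coe_finAdelicToAdelic L e dV hdV dW hdW b)).mp k.2, fun k => ⟨?_, ?_⟩⟩
  · exact (congrArg IsUnipM (map_fst_coe_finAdelicToAdelic L e dV hdV dW hdW b)).mpr isUnipM_one
  · exact (congrArg IsUnipM (map_snd_coe_finAdelicToAdelic L e dV hdV dW hdW b)).mpr k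

/-- **`N_Δ(L⁺ ⊗ ℝ) ≤ H_∞`**: the pull-back of ★ `unipDelta` along `a ↦ (a, 1)` (★ `archToAdelic`). [cite: BorelJacquet1979, §4.1] -/
def unipDeltaArch : Subgroup (UnitaryGroup.arch (Fp L) L (IsCMField.complexConj L) (n + n) (hermD L e dV hdV dW hdW)) :=
  (unipDelta L e dV hdV dW hdW).comap
    (UnitaryGroup.archToAdelic (Fp L) L (IsCMField.complexConj L) (n + n) (hermD L e dV hdV dW hdW))

/-- membership: `a ∈ N_Δ(L⁺ ⊗ ℝ) ↔ (a, 1) ∈ N_Δ(𝔸)`. [cite: BorelJacquet1979, §4.1] -/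
theorem mem_unipDeltaArch_iff (a : UnitaryGroup.arch (Fp L) L (IsCMField.complexConj L) (n + n) (hermD L e dV hdV dW hdW)) :
    a ∈ unipDeltaArch L e dV hdV dW hdW ↔
      (UnitaryGroup.archToAdelic (Fp L) L (IsCMField.complexConj L) (n + n) (hermD L e dV hdV dW hdW) a : HA L e dV hdV dW hdW) ∈
        unipDelta L e dV hdV dW hdW :=
  Iff.rfl

/-- the finite component of a unipotent element is unipotent: `u ∈ N_Δ(𝔸) → u_f ∈ N_Δ(𝔸_f)` (the matrix of `u_f` is the `𝔸_L^∞`-projection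
of the matrix of `u`, ★ `coe_finPart`). [cite: BorelJacquet1979, §4.1] -/
theorem finPart_mem_unipDeltaFin {u : HA L e dV hdV dW hdW} (hu : u ∈ unipDelta L e dV hdV dW hdW) :
    UnitaryGroup.finPart (Fp L) L (IsCMField.complexConj L) (n + n) (hermD L e dV hdV dW hdW) u ∈ unipDeltaFin L e dV hdV dW hdW := by
  rw [mem_unipDeltaFin_iff_isUnipM]
  rw [mem_unipDelta_iff_isUnipM] at hu
  exact ((isUnipM_iff_fst_snd (n := n) _).1 hu).2

/-- **`u ∈ N_Δ(𝔸) ↔ u_∞ ∈ N_Δ(L⁺ ⊗ ℝ) ∧ u_f ∈ N_Δ(𝔸_f)`** — `u = (u_∞, 1)·(1, u_f)` (★ `archToAdelic_mul_finAdelicToAdelic`), both factors in the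
subgroup `N_Δ(𝔸)` as soon as `u` and `(1, u_f)` are. [cite: BorelJacquet1979, §4.1] [cite: MoeglinWaldspurger1995, I.2.1] -/
theorem mem_unipDelta_iff_archPart_finPart (u : HA L e dV hdV dW hdW) :
    u ∈ unipDelta L e dV hdV dW hdW ↔
      UnitaryGroup.archPart (Fp L) L (IsCMField.complexConj L) (n + n) (hermD L e dV hdV dW hdW) u ∈ unipDeltaArch L e dV hdV dW hdW ∧
        UnitaryGroup.finPart (Fp L) L (IsCMField.complexConj L) (n + n) (hermD L e dV hdV dW hdW) u ∈ unipDeltaFin L e dV hdV dW hdW := by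
  -- the two factors, read in `H(𝔸)` (the carrier of ★ `unipDelta`)
  obtain ⟨a, ha⟩ : ∃ a : HA L e dV hdV dW hdW,
      a = UnitaryGroup.archToAdelic (Fp L) L (IsCMField.complexConj L) (n + n) (hermD L e dV hdV dW hdW)
        (UnitaryGroup.archPart (Fp L) L (IsCMField.complexConj L) (n + n) (hermD L e dV hdV dW hdW) u) := ⟨_, rfl⟩
  obtain ⟨b, hb⟩ : ∃ b : HA L e dV hdV dW hdW,
      b = UnitaryGroup.finAdelicToAdelic (Fp L) L (IsCMField.complexConj L) (n + n) (hermD L e dV hdV dW hdW)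
        (UnitaryGroup.finPart (Fp L) L (IsCMField.complexConj L) (n + n) (hermD L e dV hdV dW hdW) u) := ⟨_, rfl⟩
  have hsplit : a * b = u := by
    rw [ha, hb]
    exact UnitaryGroup.archToAdelic_mul_finAdelicToAdelic (Fp L) L (IsCMField.complexConj L) (n + n) (hermD L e dV hdV dW hdW) u
  rw [mem_unipDeltaArch_iff, mem_unipDeltaFin_iff, ← ha, ← hb]
  constructor
  · intro hu
    have hb' : b ∈ unipDelta L e dV hdV dW hdW := by
      rw [hb]
      exact finPart_mem_unipDeltaFin L e dV hdV dW hdW hu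
    rw [← hsplit] at hu
    exact ⟨(Subgroup.mul_mem_cancel_right _ hb').1 hu, hb'⟩
  · rintro ⟨ha', hb'⟩
    rw [← hsplit]
    exact (unipDelta L e dV hdV dW hdW).mul_mem ha' hb'

/-! ## §3 `N_Δ(L⁺_v)` and the placewise criterion -/

section Local

variable (v : HeightOneSpectrum (𝓞 (Fp L)))

/-- **`N_Δ(L⁺_v) ≤ H(L⁺_v)`**: the pull-back of ★ `unipDelta` along the place inclusion ★ `locToAdelic v` (as ★ `siegelDeltaLoc`).
[cite: MoeglinWaldspurger1995, I.2.1] [cite: Tan1999, §2] -/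
def unipDeltaLoc : Subgroup (UnitaryGroup.localPi L (IsCMField.complexConj L) (n + n) (hermD L e dV hdV dW hdW) v) :=
  (unipDelta L e dV hdV dW hdW).comap (locToAdelic L e dV hdV dW hdW v)

/-- membership: `u ∈ N_Δ(L⁺_v) ↔ ι_v u ∈ N_Δ(𝔸)`. [cite: MoeglinWaldspurger1995, I.2.1] -/
theorem mem_unipDeltaLoc_iff (u : UnitaryGroup.localPi L (IsCMField.complexConj L) (n + n) (hermD L e dV hdV dW hdW) v) :
    u ∈ unipDeltaLoc L e dV hdV dW hdW v ↔ locToAdelic L e dV hdV dW hdW v u ∈ unipDelta L e dV hdV dW hdW :=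
  Iff.rfl

/-- `N_Δ(L⁺_v) ≤ P_Δ(L⁺_v)` (★ `unipDelta_le_siegelDelta` pulled back). [cite: MoeglinWaldspurger1995, I.2.1] -/
theorem unipDeltaLoc_le_siegelDeltaLoc : unipDeltaLoc L e dV hdV dW hdW v ≤ siegelDeltaLoc L e dV hdV dW hdW v :=
  fun _ hu => unipDelta_le_siegelDelta L e dV hdV dW hdW hu

/-- membership, MATRIX FORM: **`u ∈ N_Δ(L⁺_v) ↔ IsUnipM (u_w)` for every `w ∣ v`** (the components of `ι_v u` off `v` are `1`).
[cite: MoeglinWaldspurger1995, I.2.1] [cite: BorelJacquet1979, §4.1] -/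
theorem mem_unipDeltaLoc_iff_isUnipM (u : UnitaryGroup.localPi L (IsCMField.complexConj L) (n + n) (hermD L e dV hdV dW hdW) v) :
    u ∈ unipDeltaLoc L e dV hdV dW hdW v ↔
      ∀ w : UnitaryGroup.PlacesOver L v,
        IsUnipM ((((u : UnitaryGroup.localPi L (IsCMField.complexConj L) (n + n) (hermD L e dV hdV dW hdW) v) :
            UnitaryGroup.LocalGLPi L (n + n) v) w : GL (Fin (n + n)) (w.1.adicCompletion L)) :
          Matrix (Fin (n + n)) (Fin (n + n)) (w.1.adicCompletion L)) := by
  -- `ι_v u = (1, inclPlace v u)` (★ `locToAdelic_eq_finAdelicToAdelic_inclPlace`, `rfl`), so membership is that of `inclPlace v u` in `N_Δ(𝔸_f)`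
  have h0 : u ∈ unipDeltaLoc L e dV hdV dW hdW v ↔
      UnitaryGroup.inclPlace (Fp L) L (IsCMField.complexConj L) (n + n) (hermD L e dV hdV dW hdW) v u ∈ unipDeltaFin L e dV hdV dW hdW :=
    Iff.rfl
  rw [h0, mem_unipDeltaFin_iff_isUnipM, isUnipM_iff_forall_place]
  refine ⟨fun h w => ?_, fun h w => ?_⟩
  · have hw := h w.1
    rwa [UnitaryGroup.map_eval_eq_evalAt, coe_evalAt_inclPlace_of_over] at hw
  · rw [UnitaryGroup.map_eval_eq_evalAt]
    by_cases hv : w.under (𝓞 (Fp L)) = v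
    · rw [coe_evalAt_inclPlace_of_over L e dV hdV dW hdW v u ⟨w, hv⟩]
      exact h ⟨w, hv⟩
    · rw [coe_evalAt_inclPlace_of_not_over L e dV hdV dW hdW v u w hv]
      exact isUnipM_one

end Local

/-- **`b ∈ N_Δ(𝔸_f) ↔ b_v ∈ N_Δ(L⁺_v)` for every finite place `v` of `L⁺`** (`b_v` = ★ `evalPlace v b`; both sides are `IsUnipM` at every place `w` of
`L`, grouped by `v = w ∩ 𝓞_{L⁺}`; ★ `coe_evalPlace_apply`). [cite: BorelJacquet1979, §4.1] [cite: Tan1999, §2] -/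
theorem mem_unipDeltaFin_iff_forall_evalPlace (b : UnitaryGroup.finAdelic (Fp L) L (IsCMField.complexConj L) (n + n) (hermD L e dV hdV dW hdW)) :
    b ∈ unipDeltaFin L e dV hdV dW hdW ↔
      ∀ v : HeightOneSpectrum (𝓞 (Fp L)),
        UnitaryGroup.evalPlace (Fp L) L (IsCMField.complexConj L) (n + n) (hermD L e dV hdV dW hdW) v b ∈ unipDeltaLoc L e dV hdV dW hdW v := by
  rw [mem_unipDeltaFin_iff_isUnipM, isUnipM_iff_forall_place]
  have hcomp : ∀ (v : HeightOneSpectrum (𝓞 (Fp L))) (w : UnitaryGroup.PlacesOver L v),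
      ((((UnitaryGroup.evalPlace (Fp L) L (IsCMField.complexConj L) (n + n) (hermD L e dV hdV dW hdW) v b :
            UnitaryGroup.localPi L (IsCMField.complexConj L) (n + n) (hermD L e dV hdV dW hdW) v) :
          UnitaryGroup.LocalGLPi L (n + n) v) w : GL (Fin (n + n)) (w.1.adicCompletion L)) :
        Matrix (Fin (n + n)) (Fin (n + n)) (w.1.adicCompletion L)) =
      ((b : GL (Fin (n + n)) (FiniteAdeleRing (𝓞 L) L)) : Matrix (Fin (n + n)) (Fin (n + n)) (FiniteAdeleRing (𝓞 L) L)).map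
        (AdelicGroupData.finiteAdeleEval L w.1) := by
    intro v w
    rw [UnitaryGroup.map_eval_eq_evalAt]
    rfl
  constructor
  · intro h v
    rw [mem_unipDeltaLoc_iff_isUnipM]
    intro w
    rw [hcomp]
    exact h w.1
  · intro h w
    have hw := (mem_unipDeltaLoc_iff_isUnipM L e dV hdV dW hdW (w.under (𝓞 (Fp L))) _).1 (h (w.under (𝓞 (Fp L)))) ⟨w, rfl⟩
    rwa [hcomp] at hw

/-- **COMPONENTWISE MEMBERSHIP IN `N_Δ(𝔸)`**: `u ∈ N_Δ(𝔸) ↔ u_∞ ∈ N_Δ(L⁺ ⊗ ℝ) ∧ ∀ v, (u_f)_v ∈ N_Δ(L⁺_v)`.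
[cite: BorelJacquet1979, §4.1] [cite: MoeglinWaldspurger1995, I.2.1] [cite: Tan1999, §2] -/
theorem mem_unipDelta_iff_components (u : HA L e dV hdV dW hdW) :
    u ∈ unipDelta L e dV hdV dW hdW ↔
      UnitaryGroup.archPart (Fp L) L (IsCMField.complexConj L) (n + n) (hermD L e dV hdV dW hdW) u ∈ unipDeltaArch L e dV hdV dW hdW ∧
        ∀ v : HeightOneSpectrum (𝓞 (Fp L)),
          UnitaryGroup.evalPlace (Fp L) L (IsCMField.complexConj L) (n + n) (hermD L e dV hdV dW hdW) v
              (UnitaryGroup.finPart (Fp L) L (IsCMField.complexConj L) (n + n) (hermD L e dV hdV dW hdW) u) ∈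
            unipDeltaLoc L e dV hdV dW hdW v := by
  rw [mem_unipDelta_iff_archPart_finPart, mem_unipDeltaFin_iff_forall_evalPlace]

/-- the local component of a unipotent element is unipotent: `u ∈ N_Δ(𝔸) → (u_f)_v ∈ N_Δ(L⁺_v)`. [cite: BorelJacquet1979, §4.1] -/
theorem evalPlace_finPart_mem_unipDeltaLoc {u : HA L e dV hdV dW hdW} (hu : u ∈ unipDelta L e dV hdV dW hdW)
    (v : HeightOneSpectrum (𝓞 (Fp L))) :
    UnitaryGroup.evalPlace (Fp L) L (IsCMField.complexConj L) (n + n) (hermD L e dV hdV dW hdW) v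
        (UnitaryGroup.finPart (Fp L) L (IsCMField.complexConj L) (n + n) (hermD L e dV hdV dW hdW) u) ∈
      unipDeltaLoc L e dV hdV dW hdW v :=
  (((mem_unipDelta_iff_components L e dV hdV dW hdW u).1 hu).2) v

/-- the place inclusion of a local unipotent element is unipotent: `u_v ∈ N_Δ(L⁺_v) → ι_v u_v ∈ N_Δ(𝔸)` (definitional).
[cite: MoeglinWaldspurger1995, I.2.1] -/
theorem locToAdelic_mem_unipDelta {v : HeightOneSpectrum (𝓞 (Fp L))}
    {u : UnitaryGroup.localPi L (IsCMField.complexConj L) (n + n) (hermD L e dV hdV dW hdW) v} (hu : u ∈ unipDeltaLoc L e dV hdV dW hdW v) :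
    locToAdelic L e dV hdV dW hdW v u ∈ unipDelta L e dV hdV dW hdW :=
  hu


end Summit.HodgeConjecture.HodgeConjecture.Cruxes.HLiu418.K2LiuSiegelUnipotentLocalDefs

end
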